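import Mathlib
import Summits.Parity.BatemanHorn.Theorems.IsogenyRedeiTypeIMainTermLocalCounts
import HarnessLib

/-!
# Type-I main term for Bateman–Horn (stmt-Parity-0873), input D1: counting and regrouping

Elementary bookkeeping turning the route's double sum
`∑_{n ≤ x} ∑_{d_i ∣ f_i(n), ∏ d_i ≤ X} ∏ μ(d_i) log d_i` into
`#{n} · ∑_{m ≤ X} ∑_{d_1⋯d_k = m} G(d) ∏ μ(d_i) log d_i + (error)`:

* `exists_forall_eval_pos` — the members of a Bateman–Horn system are eventually `≥ 1` at integers;
* `inner_sum_eq` — for such `n` the inner sum is a sum over the box `[1, X]^k`;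
* `sum_inner_swap` — exchanging the two summations produces the solution counts `#sysSols`;
* `abs_card_sysSols_Icc_sub_le` — `#sysSols` on an interval `= length · G(d) + O(ρ(d))`;
* `sum_box_filter_eq_sum_Ioc` — regrouping the box sum by the value of `∏ d_i`.

Everything here is proved.
-/

noncomputable section

open Finset Polynomial ArithmeticFunction Filter Topology
open scoped ArithmeticFunction.Moebius

namespace Summit.Parity.BatemanHorn.Theorems.TypeIMainTerm

open Literature.NumberTheory.Sieve Literature.NumberTheory.LFunctions

variable {k : ℕ} (f : Fin k → ℤ[X])

/-- The members of a Bateman–Horn system are eventually `≥ 1` along the natural numbers. -/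
theorem exists_forall_eval_pos (hsys : IsBatemanHornSystem f) :
    ∃ n₀ : ℕ, 1 ≤ n₀ ∧ ∀ n : ℕ, n₀ ≤ n → ∀ i, 1 ≤ (f i).eval (n : ℤ) := by
  have h : ∀ i, ∀ᶠ n : ℕ in atTop, 1 ≤ (f i).eval (n : ℤ) := by
    intro i
    set P : ℝ[X] := (f i).map (Int.castRingHom ℝ) with hP
    have hinj : Function.Injective (Int.castRingHom ℝ) := Int.cast_injective
    have hdeg : 0 < P.degree := by
      rw [hP, Polynomial.degree_map_eq_of_injective hinj,
        Polynomial.degree_eq_natDegree (hsys.irreducible i).ne_zero]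
      exact_mod_cast natDegree_member_pos f hsys i
    have hlc : 0 ≤ P.leadingCoeff := by
      rw [hP, Polynomial.leadingCoeff_map_of_injective hinj, eq_intCast]
      exact_mod_cast (hsys.leadingCoeff_pos i).le
    have ht := (Polynomial.tendsto_atTop_of_leadingCoeff_nonneg P hdeg hlc).comp
      tendsto_natCast_atTop_atTop
    filter_upwards [ht.eventually_ge_atTop 1] with n hn
    have heq : P.eval (n : ℝ) = (((f i).eval (n : ℤ) : ℤ) : ℝ) := by
      rw [hP, Polynomial.eval_map, show ((n : ℕ) : ℝ) = Int.castRingHom ℝ (n : ℤ) by simp,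
        Polynomial.eval₂_hom]
      rfl
    have : (1 : ℝ) ≤ (((f i).eval (n : ℤ) : ℤ) : ℝ) := heq ▸ hn
    exact_mod_cast this
  obtain ⟨n₀, hn₀⟩ := Filter.eventually_atTop.mp (Filter.eventually_all.mpr h)
  exact ⟨max n₀ 1, le_max_right _ _, fun n hn i => hn₀ n ((le_max_left _ _).trans hn) i⟩

/-- For `n` with all `f_i(n) ≥ 1`, the inner sum of the Type-I main term is a sum over the box
`[1, ⌊X⌋]^k` of `[∏ d_i ≤ X] [∀ i, d_i ∣ f_i(n)] w(d)`. -/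
theorem inner_sum_eq {n : ℕ} (hn : ∀ i, 1 ≤ (f i).eval (n : ℤ)) (X : ℝ) :
    ∑ d ∈ Fintype.piFinset (fun i => (((f i).eval (n : ℤ)).toNat).divisors),
        (if ∏ i, (d i : ℝ) ≤ X then ∏ i, ((μ (d i) : ℝ) * Real.log (d i)) else 0) =
      ∑ d ∈ (Fintype.piFinset fun _ : Fin k => Icc 1 ⌊X⌋₊).filter (fun d => ∏ i, (d i : ℝ) ≤ X),
        if (∀ i, ((d i : ℕ) : ℤ) ∣ (f i).eval (n : ℤ)) then wt d else 0 := by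
  classical
  rw [← Finset.sum_filter, ← Finset.sum_filter]
  refine Finset.sum_congr ?_ fun _ _ => rfl
  ext d
  simp only [Finset.mem_filter, Fintype.mem_piFinset, Nat.mem_divisors, Finset.mem_Icc]
  have hF : ∀ i, ((((f i).eval (n : ℤ)).toNat : ℕ) : ℤ) = (f i).eval (n : ℤ) := fun i =>
    Int.toNat_of_nonneg (by linarith [hn i])
  have hF0 : ∀ i, ((f i).eval (n : ℤ)).toNat ≠ 0 := fun i h => by
    have := hF i
    rw [h] at this
    push_cast at this
    linarith [hn i]
  constructor
  · rintro ⟨hd, hprod⟩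
    have hpos : ∀ i, 0 < d i := fun i =>
      Nat.pos_of_dvd_of_pos (hd i).1 (Nat.pos_of_ne_zero (hF0 i))
    refine ⟨⟨fun i => ⟨hpos i, ?_⟩, hprod⟩, fun i => ?_⟩
    · refine Nat.le_floor ?_
      have h1 : d i ≤ ∏ j, d j :=
        Nat.le_of_dvd (Finset.prod_pos fun j _ => hpos j) (Finset.dvd_prod_of_mem _ (Finset.mem_univ i))
      calc (d i : ℝ) ≤ ((∏ j, d j : ℕ) : ℝ) := by exact_mod_cast h1
        _ = ∏ j, (d j : ℝ) := by push_cast; rfl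
        _ ≤ X := hprod
    · rw [← hF i]
      exact Int.natCast_dvd_natCast.mpr (hd i).1
  · rintro ⟨⟨hd, hprod⟩, hdiv⟩
    refine ⟨fun i => ⟨?_, hF0 i⟩, hprod⟩
    have := hdiv i
    rw [← hF i] at this
    exact Int.natCast_dvd_natCast.mp this

/-- Exchanging the order of summation: `∑_n ∑_d [d ∣ f(n)] w(d) = ∑_d w(d) · #sysSols`. -/
theorem sum_inner_swap (s : Finset ℕ) (T : Finset (Fin k → ℕ)) :
    ∑ n ∈ s, ∑ d ∈ T, (if (∀ i, ((d i : ℕ) : ℤ) ∣ (f i).eval (n : ℤ)) then wt d else 0) =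
      ∑ d ∈ T, wt d * ((sysSols f d s).card : ℝ) := by
  classical
  rw [Finset.sum_comm]
  refine Finset.sum_congr rfl fun d _ => ?_
  rw [← Finset.sum_filter]
  unfold sysSols
  rw [Finset.sum_const, nsmul_eq_mul, mul_comm]

/-- Counting solutions on `[n₀, x]`: `#sysSols = (x + 1 − n₀) G(d) + O(ρ(d))`. -/
theorem abs_card_sysSols_Icc_sub_le (d : Fin k → ℕ) (hd : ∀ i, 0 < d i) (n₀ x : ℕ) :
    |((sysSols f d (Icc n₀ x)).card : ℝ) - ((x + 1 - n₀ : ℕ) : ℝ) * sysDensity f d| ≤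
      sysCount f d := by
  rcases le_or_gt n₀ (x + 1) with hn₀ | hn₀
  · have hL := tupleLcm_pos hd
    have h := abs_card_filter_Ico_sysPred_sub_le f d hL n₀ (x + 1 - n₀)
    have hI : Ico n₀ (n₀ + (x + 1 - n₀)) = Icc n₀ x := by
      ext m
      rw [Finset.mem_Ico, Finset.mem_Icc]
      omega
    rw [hI] at h
    unfold sysDensity
    convert h using 3
    ring
  · have h1 : Icc n₀ x = ∅ := Finset.Icc_eq_empty (by omega)
    have h2 : x + 1 - n₀ = 0 := by omega
    rw [h1, h2]
    unfold sysSols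
    simp

/-- Regrouping the box sum by the value of the product:
`∑_{d ∈ [1,⌊X⌋]^k, ∏ d_i ≤ X} G(d) = ∑_{m ≤ ⌊X⌋} ∑_{d_1⋯d_k = m} G(d)`. -/
theorem sum_box_filter_eq_sum_Ioc {β : Type*} [AddCommMonoid β] (G : (Fin k → ℕ) → β) {X : ℝ}
    (hX : 0 ≤ X) :
    ∑ d ∈ (Fintype.piFinset fun _ : Fin k => Icc 1 ⌊X⌋₊).filter (fun d => ∏ i, (d i : ℝ) ≤ X), G d =
      ∑ m ∈ Ioc 0 ⌊X⌋₊, ∑ d ∈ Nat.finMulAntidiag k m, G d := by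
  classical
  set D₀ := ⌊X⌋₊ with hD₀
  have key := RudnickSarnakN.sum_Icc_sum_finMulAntidiag_eq (r := k) (N := D₀) (B := max (D₀ ^ k) D₀)
    (le_max_left _ _) (fun m ν => if m ≤ D₀ ∧ ∀ i, ν i ≤ D₀ then G ν else 0) (fun m ν hex => by
      obtain ⟨i, hi⟩ := hex
      rw [if_neg]
      rintro ⟨-, h⟩
      exact absurd (h i) (not_le.mpr hi))
  have hR : ∀ ν ∈ Fintype.piFinset (fun _ : Fin k => Icc 1 D₀),
      (if (∏ i, ν i) ≤ D₀ ∧ ∀ i, ν i ≤ D₀ then G ν else 0) =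
        if ∏ i, (ν i : ℝ) ≤ X then G ν else 0 := by
    intro ν hν
    rw [Fintype.mem_piFinset] at hν
    have hνi : ∀ i, ν i ≤ D₀ := fun i => (Finset.mem_Icc.mp (hν i)).2
    by_cases h : ∏ i, (ν i : ℝ) ≤ X
    · rw [if_pos h, if_pos ⟨(Nat.le_floor_iff hX).mpr (by exact_mod_cast h), hνi⟩]
    · rw [if_neg h, if_neg]
      rintro ⟨h', -⟩
      have := (Nat.le_floor_iff hX).mp h'
      push_cast at this
      exact h this
  rw [Finset.sum_congr rfl hR] at key
  rw [Finset.sum_filter, ← key]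
  calc ∑ m ∈ Icc 1 (max (D₀ ^ k) D₀), ∑ ν ∈ Nat.finMulAntidiag k m,
          (if m ≤ D₀ ∧ ∀ i, ν i ≤ D₀ then G ν else 0)
      = ∑ m ∈ Icc 1 (max (D₀ ^ k) D₀), if m ≤ D₀ then ∑ ν ∈ Nat.finMulAntidiag k m, G ν else 0 := by
        refine Finset.sum_congr rfl fun m hm => ?_
        rw [Finset.mem_Icc] at hm
        by_cases hmD : m ≤ D₀
        · rw [if_pos hmD]
          refine Finset.sum_congr rfl fun ν hν => ?_
          rw [if_pos]
          exact ⟨hmD, fun i => (Nat.le_of_dvd (by omega) (Nat.dvd_of_mem_finMulAntidiag hν i)).trans hmD⟩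
        · rw [if_neg hmD]
          exact Finset.sum_eq_zero fun ν _ => by rw [if_neg]; exact fun h => hmD h.1
    _ = ∑ m ∈ (Icc 1 (max (D₀ ^ k) D₀)).filter (fun m => m ≤ D₀), ∑ ν ∈ Nat.finMulAntidiag k m, G ν := by
        rw [Finset.sum_filter]
    _ = ∑ m ∈ Ioc 0 D₀, ∑ ν ∈ Nat.finMulAntidiag k m, G ν := by
        refine Finset.sum_congr ?_ fun _ _ => rfl
        ext m
        simp only [Finset.mem_filter, Finset.mem_Icc, Finset.mem_Ioc]
        constructor
        · rintro ⟨⟨h1, -⟩, h2⟩; exact ⟨h1, h2⟩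
        · rintro ⟨h1, h2⟩; exact ⟨⟨h1, h2.trans (le_max_right _ _)⟩, h2⟩

end Summit.Parity.BatemanHorn.Theorems.TypeIMainTerm

end
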